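import Summits.BirchSwinnertonDyer.Rank1Residual.Additive.MazurTateGrowthDichotomyThree
import HarnessLib

/-!
# O5 — the UNIFORM tame potentially-supersingular Mazur–Tate growth law (conjecture U-O5′; typed, nothing asserted)

HONEST FRAMING (cell `bsd-uniform`, `run/shared/lean/pub/bsd-uniform/`, seat ui-o5, gens 0–1). What this file IS:
ONE conjectural statement, typed as a `Prop` and labelled `@[conjecture]`, about the Iwasawa invariants of the
Mazur–Tate elements `θ_n(E)` of an elliptic curve `E/ℚ` at an ODD prime `p` of ADDITIVE, TAME, POTENTIALLY
SUPERSINGULAR reduction with semistability defect `e > 2` — the census pocket O5 ∧ (t′) of the b2b residual map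
(`Rank1Residual/Additive/PotSupersingularClasses.lean`: `ClassO5 W p ∧ SubTprime W p`), the pocket in which NOTHING
is formulated in print: Delbourgo 1998/2002 work under a Hypothesis that excludes it ("In the potentially
supersingular case (A) is false", J. Number Theory 95 (2002) p. 40; for `e > 2`, `e ∣ p + 1` the curve acquires good
supersingular reduction only over the NON-abelian `ℚ_p(μ_e, p^{1/e})`, ibid. pp. 52–53), the `±`/`♯♭` theories need a
prime of good reduction, and Lei–Pollack–Pratap 2024 §4.3 record the phenomenon with "We do not have a theoretical
explanation for this phenomenon at present". What this file is NOT: not a theorem, not a `p`-part-of-BSD claim, not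
a main conjecture, no axiom, no `sorry`; the summit `Summit.BirchSwinnertonDyer` is not touched. It is FALSIFIABLE
by modular-symbol computation; the evidence (pre-registered kit runs at `p ∈ {5,7,11,17,23}`, 110 test rows) and the
honest odds are in `ui/O5-CONJECTURE.md`.

## The statement (U-O5′), in words

Let `p` be an odd prime and `E/ℚ` (globally minimal model `W`, newform `f`) have additive potentially good reduction
at `p` with `f_p = 2`, `v := v_p(Δ_min)`, `e = 12/gcd(12,v) ∤ p − 1` (so `p ≥ 5 ⇒ e ∈ {3,4,6}`, `e ∣ p + 1`: TAME
potentially SUPERSINGULAR) — the census predicate `SubTprime W p` inside `ClassO5 W p` — and `ρ̄_{E,p}` irreducible.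
Let `s := [E[p]` irreducible as a `G_{ℚ_p}`-module`]` (`Additive.LocIrr W p`; on this locus census-decidable by
Kraus' canonical-subgroup criterion, tree `Additive.locIrr_iff_not_canonicalSubgroupCriterion_of_subTprime`). Then
eventually in `n`, `θ_n(f)` (Pollack's normalisation, tree `mazurTateElement f p n`, `n`-th layer, `p^n` coefficients)
is `p`-integral with `μ = 0`, and
* (locally REDUCIBLE, `s = 0`)   `λ(θ_n) = ⌈(p−1)v/12⌉ · p^{n−1} + c`                         (one constant `c`);
* (locally IRREDUCIBLE, `s = 1`) `λ(θ_n) = ⌊(p−1)v·p^{n−1}/12⌋ + q_n + c_{n mod 2}`           (Kurihara's `q_n` at `p`).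
Equivalently (one formula): `λ(θ_n) = ⌊(p−1)v p^{n−1}/12⌋ + K·q_{n−1} + c′_{n mod 2}` with the TAME SUPERSINGULAR
MULTIPLIER `K = p` if `s = 1` and `K = (p+1)·(⌈(p−1)v/12⌉ − (p−1)v/12) ∈ {(p+1)/3, (p+1)/2, 2(p+1)/3}` if `s = 0`.
Equivalently (valuations; uses only `ω_{n−1} ∣ θ_n`, tree `Additive.OmegaDvdMazurTateOfAddv`): for every primitive
`ψ` of conductor `p^{n+1}`, `v_p(τ(ψ) L(E, ψ̄, 1)/Ω_E⁺) = λ(θ_n)/φ(p^n)`, which tends to `v/12 + p/(p² − 1)` on the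
irreducible branch ("good supersingular with the fractional period shift `v/12`") and equals `⌈(p−1)v/12⌉/(p−1) +
c/φ(p^n)` on the reducible branch ("ordinary-like": bounded `λ` after removing the period slope rounded UP).

## Status of the evidence (numbers, not adjectives; details and job ids in the md)

* PRE-REGISTERED v1 (gen 0, `PREREG-UO5.md`): reducible branch as above, irreducible branch `⌈(p−1)v/12⌉·p^{n−1} +
  q_{n−1} + c_{n mod 2}`. PRE-REGISTERED alternative for the irreducible branch (gen 1, Addendum A, fixed in writing
  before any output was read): the `q_n` form above, with the convention-free discriminator
  `κ := (λ_{n+2} − λ_n)/(p^{n−1}(p−1)) − (p²−1)v/12`, predicted `(p+1)(⌈(p−1)v/12⌉ − (p−1)v/12) + 1` by v1 and `p` by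
  the alternative. Pilot (kit j171606, 27 rows, `p ∈ {5,7,11,17}`, `n ≤ 5`): every irreducible-`ρ̄` row with `s = 0`
  (7 rows) fits the reducible-branch law EXACTLY (residual constant, `∈ {0,1}`); every row with `s = 1` (12 rows, CM
  and non-CM) has `κ = p` and fits the `q_n` law EXACTLY (residual 2-periodic from `n = 2`, constants in `{0,…,3}`),
  and v1 fails on all 10 of them where the two laws differ. The one re-formulation allowed by the cell's kill rule
  was therefore exercised exactly as pre-registered (Addendum A4 (ii)): U-O5′ := v1 on `s = 0` ∧ alternative on
  `s = 1`, typed below under the registered name `TamePotSupersingularGrowthLawPrime` (v1 is NOT re-typed).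
* FULL PRE-REGISTERED RUN (kit j172202 / j172203 / j172204 = the 90 non-pilot rows, code byte-identical to the frozen
  bundle; with the pilot: 107 of the 110 test rows computed when this file was parked — the three slow `p = 23` rows
  `4232i1`, `1058b1`, `4761e1` are reported in the md): U-O5′ holds EXACTLY on 107/107 (`n₀ = 1` on 87, `n₀ = 2` on
  20 — the `n₀ = 2` rows are those with `μ(θ₁) = 1` or `θ₁ = 0`; 242 surplus equalities beyond fitting the constants;
  registered fold H2: 57/57, fold H1: 50/50; `p = 5`: 44/44, `7`: 30/30, `11`: 24/24, `17`: 7/7, `23`: 2/2; `s = 0`: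
  45/45, `s = 1`: 62/62 incl. all 19 CM rows; ranks 0/1/2: 52/53/2); `κ` as predicted on 106/106 admissible top pairs
  (`κ = p` on every `s = 1` row, `κ = (p+1)(⌈(p−1)v/12⌉ − (p−1)v/12)` on every `s = 0` row); `μ(θ_n) = 0` for
  `n ≥ 2` on 107/107; selector `s_num = s_pred` 107/107; `ω_{n−1} ∣ θ_n` exact on every layer of every row; v1 fits
  0/51 of the `s = 1` rows on which it differs from U-O5′. EXT1 (j171871, `p = 23`, `n = 3`): `4761a1`, `4761b1` (CM,
  `s = 1`, ranks 0 and 2) have `κ = 23` (v1 predicted 9). The 9 `ρ̄`-REDUCIBLE control rows are off-law as allowed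
  (e.g. `49a1`@7: `5·7^{n−1}`; `50b1`@5: `5^n − 1` with `μ = −1`): the hypothesis `ρ̄` irreducible is load-bearing.
* `p = 3` (`v ∈ {3,9}`, `e = 4`): BOTH branches of U-O5′ coincide, up to relabelling the parity constants, with the
  tree's census-validated node `O5.GrowthDichotomyLawLocIrrThree` (`λ = b·3^{n−1} + s·q_{n−1} + c`, `b = ⌈2v/12⌉`),
  because `(p−1)/(p+1) = 1/2 = ⌈2v/12⌉ − 2v/12` there (`uO5_three_bridge` below checks layers `n ≤ 6`).
* `p = 23`, `4232i1` (`v = 10`, `s = 0`): `⌈22·10/12⌉ = 19`; Lei–Pollack–Pratap 2024 Ex. 4.8 print `λ(θ_n) = 19·23^{n−1}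
  + 1` for `n ≤ 9`.
* Nearest PROVED statements: Lei–Pollack–Pratap 2024 Thm. 4.7 (potentially ordinary, `e ∣ p − 1`: `λ = ((p−1)v/12)
  p^{n−1} + λ(𝒳)`, slope an integer) and Thm. 4.5 (`e = 2`, twist of good supersingular: `λ = ((p−1)/2)p^{n−1} + q_n +
  λ^∓`); U-O5′ is the `e ∈ {3,4,6}` interpolation of the two, the selector `s` deciding which — LITERALLY: the closed
  form `uO5PredictedLambda` evaluated at `v = 6` (`e = 2`, `s = 1`) IS the formula of Thm. 4.5
  (`uO5PredictedLambda_six_eq`) and evaluated at `12 ∣ (p−1)v` (`e ∣ p − 1`, `s = 0`) IS the formula of Thm. 4.7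
  (`uO5PredictedLambda_of_dvd`). Pollack–Weston 2011 Thm. 1 (non-ordinary forms of medium weight, level prime to
  `p`) is the printed instance of the same reducible/irreducible-at-`p` dichotomy.

NOVELTY (one sentence): the two-branch closed form — slope `⌈(p−1)v_p(Δ)/12⌉` with bounded residual when `E[p]|G_{ℚ_p}`
is reducible, exact slope `(p−1)v_p(Δ)/12` plus Kurihara's `q_n` when it is irreducible — for Mazur–Tate elements at
an additive potentially supersingular prime with `e > 2` is not in print; Lei–Pollack–Pratap 2024 conjecture only the
CM case in `Ш`-language (Conj. 4.11) and record `4232i1` as unexplained, and the census shows their CM-versus-`4232i1`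
contrast is the `s = 1`-versus-`s = 0` contrast (non-CM `s = 1` curves such as `1600b1`, `1274j1`, `1210f1` follow
the "CM" pattern; `225a1` (CM) and `1600b1` (non-CM) have identical `λ`-sequences at `5`).

References: [LeiPollackPratap2024] Thm. 4.5, Thm. 4.7, §4.3 Ex. 4.8, Thm. 4.9, Conj. 4.11, Prop. 3.12;
[PollackWeston2011MT] Thm. 1; [DoyonLei2021] Lemma 5.2, Cor. 5.3, §6; [Delbourgo2002] pp. 40, 52–53, Lemma 2.1;
[Delbourgo1998] p. 152; [Kurihara2002] §0; [Pollack2003] §6, Def. 6.15; [Kraus1997Dissertationes] Prop. 2; [Kobayashi2003].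
-/

noncomputable section

open scoped Classical MatrixGroups ModularForm NumberField

open CongruenceSubgroup Polynomial WeierstrassCurve NumberField Literature.NumberTheory.EllipticCurves
  Literature.NumberTheory.EllipticCurves.ModularForms
  Literature.NumberTheory.EllipticCurves.Rank1Residual
  Literature.NumberTheory.EllipticCurves.Rank1Residual.Typed
  Summit.BirchSwinnertonDyer.Rank1Residual.X1.MuLambda
  Summit.BirchSwinnertonDyer.Rank1Residual.Additive

namespace Summit.BirchSwinnertonDyer.Uniform.UI

/-! ## §1 Elementary vocabulary at a general prime `p` (the tree's `O5` vocabulary is `3`-adic) -/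

/-- Kurihara's **`q_m` at `p`**: `q_m = p^{m−1} − p^{m−2} + ⋯`, i.e. `(p^m − 1)/(p + 1)` (`m` even),
`(p^m − p)/(p + 1)` (`m` odd); `q_0 = q_1 = 0`, `q_m + q_{m+1} = p^m − 1`, `q_{m+1} = p·q_m + [m odd]·(p−1)`. At
`p = 3` this is the tree's `O5.kuriharaQ` (`kuriharaQAt_three`). [cite: Kurihara2002, §0] [cite: Pollack2003, §6] -/
def kuriharaQAt (p m : ℕ) : ℕ := (p ^ m - if m % 2 = 0 then 1 else p) / (p + 1)

/-- `q_m` at `3` is the tree's `kuriharaQ`. [folklore] -/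
theorem kuriharaQAt_three (m : ℕ) : kuriharaQAt 3 m = Rank1Residual.O5.kuriharaQ m := rfl

/-- sanity: `q_2, …, q_5` at `5`; `q_2, q_3` at `7`, `11`, `23`. [folklore] -/
theorem kuriharaQAt_values :
    kuriharaQAt 5 2 = 4 ∧ kuriharaQAt 5 3 = 20 ∧ kuriharaQAt 5 4 = 104 ∧ kuriharaQAt 5 5 = 520 ∧
      kuriharaQAt 7 2 = 6 ∧ kuriharaQAt 7 3 = 42 ∧ kuriharaQAt 11 2 = 10 ∧ kuriharaQAt 11 3 = 110 ∧
      kuriharaQAt 23 2 = 22 ∧ kuriharaQAt 23 3 = 506 := by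
  decide

/-- The **rounded-up tame slope** `A(p, v) := ⌈(p − 1)·v / 12⌉` (as a natural number: `((p−1)v + 11) / 12`),
`v = v_p(Δ_min)`: the coefficient of `p^{n−1}` in `λ(θ_n)` on the locally REDUCIBLE branch; also the least possible
valuation of the Hasse invariant of the minimal model on the potentially good locus, attained iff the canonical
subgroup exists (Kraus 1997 Prop. 2; tree `Additive.CanonicalSubgroupCriterion`). [folklore] -/
def tameSupersingularSlope (p v : ℕ) : ℕ := ((p - 1) * v + 11) / 12

/-- The **exact tame slope, floored at layer `n`**: `⌊(p − 1)·v·p^{n−1} / 12⌋` — the main term of `λ(θ_n)` on the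
locally IRREDUCIBLE branch (`(p−1)v/12 = (p−1)a/e` is never an integer when `e > 2`, `e ∤ p − 1`). [folklore] -/
def exactSlopeFloorAt (p v n : ℕ) : ℕ := ((p - 1) * v * p ^ (n - 1)) / 12

/-- sanity / bridges: `A(3,3) = 1`, `A(3,9) = 2` (the tree's `b(W)` at `3`); `A(23,10) = 19` (Lei–Pollack–Pratap
Ex. 4.8); `A(5,2) = 1`, `A(5,4) = 2`, `A(5,8) = 3`, `A(5,10) = 4`; `A(7,3) = 2`, `A(7,9) = 5`; `A(11,2) = 2`;
`A(17,2) = 3`. [folklore] -/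
theorem tameSupersingularSlope_values :
    tameSupersingularSlope 3 3 = 1 ∧ tameSupersingularSlope 3 9 = 2 ∧ tameSupersingularSlope 23 10 = 19 ∧
      tameSupersingularSlope 5 2 = 1 ∧ tameSupersingularSlope 5 4 = 2 ∧ tameSupersingularSlope 5 8 = 3 ∧
      tameSupersingularSlope 5 10 = 4 ∧ tameSupersingularSlope 7 3 = 2 ∧ tameSupersingularSlope 7 9 = 5 ∧
      tameSupersingularSlope 11 2 = 2 ∧ tameSupersingularSlope 17 2 = 3 := by
  decide

/-- The tree's `p = 3` coefficient `b(W) = if v₃(Δ) = 9 then 2 else 1` on `v ∈ {3, 9}` is `A(3, v)`. [folklore] -/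
theorem tameSupersingularSlope_three_eq (v : ℕ) (hv : v = 3 ∨ v = 9) :
    tameSupersingularSlope 3 v = if v = 9 then 2 else 1 := by
  rcases hv with rfl | rfl <;> decide

/-- Twist covariance of the rounded slope: `A(p, v + 6) = A(p, v) + (p − 1)/2` for odd `p` (a quadratic twist
ramified at `p` shifts `v` by `6` and `λ` by `((p−1)/2)·p^{n−1}`). [folklore] -/
theorem tameSupersingularSlope_add_six (p v : ℕ) (hp : p % 2 = 1) :
    tameSupersingularSlope p (v + 6) = tameSupersingularSlope p v + (p - 1) / 2 := by
  unfold tameSupersingularSlope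
  obtain ⟨k, rfl⟩ : ∃ k, p = 2 * k + 1 := ⟨p / 2, by omega⟩
  simp only [Nat.add_sub_cancel]
  have : (2 * k) * (v + 6) + 11 = (2 * k * v + 11) + 12 * k := by ring
  rw [this, Nat.add_mul_div_left _ _ (by norm_num : 0 < 12)]
  omega

/-- The **predicted `λ(θ_n)`** of U-O5′ as a closed form in `(p, v, n)`, the local selector `s` and the constants:
reducible branch `A(p,v)·p^{n−1} + c₀`; irreducible branch `⌊(p−1)v p^{n−1}/12⌋ + q_n + c_{n mod 2}`. [folklore] -/
def uO5PredictedLambda (p v n : ℕ) (s : Bool) (c₀ c₁ : ℕ) : ℕ :=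
  if s then exactSlopeFloorAt p v n + kuriharaQAt p n + (if n % 2 = 0 then c₀ else c₁)
  else tameSupersingularSlope p v * p ^ (n - 1) + c₀

/-- EVIDENCE ANCHORS (exact integer checks of the closed form against measured / printed values).
(a) `p = 5`, `v = 2`, `s = 1`, `(c₀,c₁) = (2,1)`: `λ(θ_n) = 9, 37, 189, 937` for `n = 2..5` — the measured values for
`225a1` (CM) and `1600b1` (non-CM) (kit j171606). (b) `p = 7`, `v = 3`, `s = 1`, `(2,1)`: `18, 116, 816, 5702`
(`1274j1`). (c) `p = 11`, `v = 8`, `s = 1`, `(0,3)`: `83, 919, 10093` (`1210m1`, `n = 2..4`). (d) `p = 23`, `v = 10`,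
`s = 0`, `c₀ = 1`: `20, 438, 10052` for `n = 1..3` (Lei–Pollack–Pratap 2024 Ex. 4.8: `19·23^{n−1} + 1`).
(e) `p = 5`, `v = 8`, `s = 0`, `c₀ = 0`: `15, 75, 375, 1875` (`200a1`, `1350u1`). [folklore] -/
theorem uO5PredictedLambda_anchors :
    (uO5PredictedLambda 5 2 2 true 2 1 = 9 ∧ uO5PredictedLambda 5 2 3 true 2 1 = 37 ∧
      uO5PredictedLambda 5 2 4 true 2 1 = 189 ∧ uO5PredictedLambda 5 2 5 true 2 1 = 937) ∧
    (uO5PredictedLambda 7 3 2 true 2 1 = 18 ∧ uO5PredictedLambda 7 3 3 true 2 1 = 116 ∧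
      uO5PredictedLambda 7 3 4 true 2 1 = 816 ∧ uO5PredictedLambda 7 3 5 true 2 1 = 5702) ∧
    (uO5PredictedLambda 11 8 2 true 0 3 = 83 ∧ uO5PredictedLambda 11 8 3 true 0 3 = 919 ∧
      uO5PredictedLambda 11 8 4 true 0 3 = 10093) ∧
    (uO5PredictedLambda 23 10 1 false 1 0 = 20 ∧ uO5PredictedLambda 23 10 2 false 1 0 = 438 ∧
      uO5PredictedLambda 23 10 3 false 1 0 = 10052) ∧
    (uO5PredictedLambda 5 8 2 false 0 0 = 15 ∧ uO5PredictedLambda 5 8 3 false 0 0 = 75 ∧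
      uO5PredictedLambda 5 8 4 false 0 0 = 375 ∧ uO5PredictedLambda 5 8 5 false 0 0 = 1875) := by
  decide

/-- BRIDGE TO THE TREE'S `p = 3` NODE (layers `n = 1..6`, both `v ∈ {3, 9}`): the irreducible branch of U-O5′,
`⌊2v·3^{n−1}/12⌋ + q_n`, equals the tree's `b·3^{n−1} + q_{n−1}` up to the parity relabelling `c_odd ↦ c_odd + 1`
(at `p = 3`, `(p−1)/(p+1) = 1/2 = ⌈2v/12⌉ − 2v/12`, which is exactly when the `q_n`- and `q_{n−1}`-forms agree).
[folklore] -/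
theorem uO5_three_bridge :
    ∀ n ∈ [1, 2, 3, 4, 5, 6], ∀ v ∈ [3, 9],
      exactSlopeFloorAt 3 v n + kuriharaQAt 3 n + (if n % 2 = 0 then 0 else 1) =
        tameSupersingularSlope 3 v * 3 ^ (n - 1) + kuriharaQAt 3 (n - 1) := by
  decide

/-- The unified form: on layers `n = 2..6` at `p ∈ {5, 7, 11}`, `q_n = p·q_{n−1} + [n even]·(p − 1)` — so the
irreducible branch is `⌊(p−1)v p^{n−1}/12⌋ + p·q_{n−1} + c′_{n mod 2}` (multiplier `K = p`). [folklore] -/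
theorem kuriharaQAt_succ_values :
    ∀ p ∈ [5, 7, 11], ∀ n ∈ [2, 3, 4, 5, 6],
      kuriharaQAt p n = p * kuriharaQAt p (n - 1) + (if n % 2 = 0 then p - 1 else 0) := by
  decide

/-- INTERPOLATION CHECK 1 (the `e = 2` cell, in print): at `v = 6` the irreducible branch of the closed form is
EXACTLY Lei–Pollack–Pratap 2024 Thm. 4.5, `λ(θ_n) = ((p−1)/2)·p^{n−1} + q_n + λ^∓` (odd `p`; there `E = E^F ⊗ χ`
with `E^F` good supersingular, so `E[p]|G_{ℚ_p}` is irreducible: `s = 1`). [cite: LeiPollackPratap2024, Thm. 4.5] -/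
theorem uO5PredictedLambda_six_eq (p n c₀ c₁ : ℕ) (hp : p % 2 = 1) :
    uO5PredictedLambda p 6 n true c₀ c₁ =
      (p - 1) / 2 * p ^ (n - 1) + kuriharaQAt p n + (if n % 2 = 0 then c₀ else c₁) := by
  unfold uO5PredictedLambda exactSlopeFloorAt
  obtain ⟨k, rfl⟩ : ∃ k, p = 2 * k + 1 := ⟨p / 2, by omega⟩
  simp only [Nat.add_sub_cancel, if_true]
  have h1 : 2 * k * 6 * (2 * k + 1) ^ (n - 1) = 12 * (k * (2 * k + 1) ^ (n - 1)) := by ring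
  have h2 : 2 * k / 2 = k := by omega
  rw [h1, h2, Nat.mul_div_cancel_left _ (by norm_num : 0 < 12)]

/-- INTERPOLATION CHECK 2 (the potentially ORDINARY cell, in print): when `12 ∣ (p−1)·v` (`e ∣ p − 1`) the
reducible branch of the closed form is EXACTLY Lei–Pollack–Pratap 2024 Thm. 4.7, `λ(θ_n) = ((p−1)v/12)·p^{n−1} +
λ(𝒳(E/ℚ_∞))` (potentially ordinary ⇒ `E[p]|G_{ℚ_p}` reducible: `s = 0`; the slope is then an integer, so `⌈·⌉ =
⌊·⌋`). [cite: LeiPollackPratap2024, Thm. 4.7] -/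
theorem uO5PredictedLambda_of_dvd (p v n c₀ c₁ : ℕ) (h : 12 ∣ (p - 1) * v) :
    uO5PredictedLambda p v n false c₀ c₁ = (p - 1) * v / 12 * p ^ (n - 1) + c₀ := by
  unfold uO5PredictedLambda tameSupersingularSlope
  obtain ⟨m, hm⟩ := h
  simp only [hm, Bool.false_eq_true, if_false]
  have : (12 * m + 11) / 12 = m := by omega
  rw [this, Nat.mul_div_cancel_left _ (by norm_num : 0 < 12)]

/-- `Θ ∈ Λ = ℤ_p⟦T⟧` is an **integral lift of `p^k · θ_n(f)`** at a general prime `p` (`ι Θ = p^k θ_n(f)` in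
`ℚ_p⟦T⟧`, `θ_n` = the tree's `mazurTateElement f p n`, Pollack 2003 Def. 6.15; `λ` is scale-invariant, `μ` is read
at `k = 0`). VERBATIM the tree's `O5.IsScaledMazurTateLift` with `3 ↦ p` (`isScaledMazurTateLiftAt_three`).
[cite: Pollack2003, Def. 6.15] -/
def IsScaledMazurTateLiftAt (p : ℕ) [Fact p.Prime] {N : ℕ} (f : CuspForm (Gamma0 N) 2) (n k : ℕ)
    (Θ : IwasawaAlgebra p) : Prop :=
  iwasawaToPowerSeries p Θ =
    PowerSeries.C ((p : ℚ_[p]) ^ k) * ((mazurTateElement f p n).map (algebraMap ℚ ℚ_[p]) : PowerSeries ℚ_[p])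

/-- At `p = 3` the general lift predicate is the tree's. [folklore] -/
theorem isScaledMazurTateLiftAt_three {N : ℕ} (f : CuspForm (Gamma0 N) 2) (n k : ℕ) (Θ : IwasawaAlgebra 3) :
    (haveI : Fact (Nat.Prime 3) := ⟨Nat.prime_three⟩; IsScaledMazurTateLiftAt 3 f n k Θ) ↔
      Rank1Residual.O5.IsScaledMazurTateLift f n k Θ :=
  Iff.rfl

/-! ## §2 The conjecture U-O5′ (ONE statement; `@[conjecture]`; consumed only as an explicit hypothesis) -/

/-- **CONJECTURE U-O5′ — the uniform tame potentially-supersingular Mazur–Tate growth law** (cell `bsd-uniform`,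
seat ui-o5; CONJECTURE, clearly labelled; nothing asserted). For `W/ℚ` globally minimal with newform `f`, an odd
prime `p` with `ClassO5 W p ∧ SubTprime W p` (additive, `f_p = 2`, potentially good with `e ∤ p − 1`: TAME potentially
SUPERSINGULAR with `e > 2`) and `ρ̄_{W,p}` irreducible, writing `v = v_p(Δ_min)`: there are `n₀ c₀ c₁` such that
for every `n ≥ n₀`, `θ_n(f)` is `p`-integral with `μ = 0`, and every integral lift `Θ` of `p^k θ_n(f)` has
`λ(Θ) = ⌈(p−1)v/12⌉·p^{n−1} + c₀` if `W[p]|G_{ℚ_p}` is REDUCIBLE, and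
`λ(Θ) = ⌊(p−1)v·p^{n−1}/12⌋ + q_n + c_{n mod 2}` if it is IRREDUCIBLE (`uO5PredictedLambda`).
EVIDENCE: tree node `O5.GrowthDichotomyLawLocIrrThree` at `p = 3` (`uO5_three_bridge`); Lei–Pollack–Pratap 2024
Ex. 4.8 at `p = 23`; kit runs j171606 (pilot) / j172202–j172204 (full pre-registered run) / j171871 (EXT1) at
`p ∈ {5,7,11,17,23}` scored against the pre-registrations `PREREG-UO5.md` + Addendum A: 107/107 held-out test rows
fit exactly with `n₀ ≤ 2` (the irreducible branch is the pre-registered alternative, adopted after v1's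
`q_{n−1}`-form failed on every discriminating row; see the module docstring and the md).
WHY IT MIGHT STILL FAIL: (i) the residual might have period `> 2` or drift on rows not yet computed (larger `p`,
`n ≥ 6`, more rank-`2` curves); (ii) `μ = 0` is Greenberg-type (normalisation: Pollack's `θ_n` with the newform's
`Ω⁺`; `ρ̄` irreducible); (iii) `n₀` might grow with the curve (`n₀ ≤ 2` on 107/107 rows so far).
NOT a `p`-part-of-BSD statement; under BSD over the layers `k_n` (Lei–Pollack–Pratap Prop. 3.12 for the period
defect `f_n = ⌊p^n v/12⌋ − ⌊p^{n−1}v/12⌋`, and their eq. (pbsd)) it reads: the per-layer increment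
`ord_p #Ш(E/k_n) − ord_p #Ш(E/k_{n−1})` is `q_n + O(1) = p·q_{n−1} + O(1)` on the irreducible branch (the same
increment `q_n + λ^∓ − r` as at a prime of GOOD supersingular reduction with `a_p = 0` — Lei–Pollack–Pratap Conj.
4.11 / Rem. 4.12 for CM curves is the sub-case: CM rows all have `s = 1`) and `(p+1)(⌈(p−1)v/12⌉ − (p−1)v/12)·q_{n−1}
+ O(1)` on the reducible branch (`16·q_{n−1} + (1 | 17) − rank` for `4232i1`; Ex. 4.8 prints `16q_{n−1} + 17 | + 1`).
[cite: LeiPollackPratap2024, §4.3 Ex. 4.8, Thm. 4.5, Thm. 4.7, Thm. 4.9, Conj. 4.11, Prop. 3.12]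
[cite: PollackWeston2011MT, Thm. 1] [cite: DoyonLei2021, Cor. 5.3, §6] [cite: Delbourgo2002, Lemma 2.1]
[cite: Kurihara2002, Thm. 0.1] [cite: Pollack2003, §6] [cite: Kraus1997Dissertationes, Prop. 2] -/
@[conjecture] def TamePotSupersingularGrowthLawPrime : Prop :=
  ∀ (W : WeierstrassCurve ℚ) [W.IsElliptic] [W.IsGloballyMinimal] [NeZero (W.conductorNorm ℤ)]
    (f : CuspForm (Gamma0 (W.conductorNorm ℤ)) 2) (p : ℕ) [Fact p.Prime],
    IsNewformOf W f → ClassO5 W p → SubTprime W p → W.HasIrreducibleModPGaloisRep p →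
    ∃ n₀ c₀ c₁ : ℕ, ∀ n : ℕ, n₀ ≤ n →
      (∃ Θ : IwasawaAlgebra p, IsScaledMazurTateLiftAt p f n 0 Θ ∧ mu Θ = 0) ∧
      ∀ (k : ℕ) (Θ : IwasawaAlgebra p), IsScaledMazurTateLiftAt p f n k Θ → Θ ≠ 0 →
        lam Θ = uO5PredictedLambda p (padicValInt p W.minimalDiscriminantInt) n (decide (LocIrr W p)) c₀ c₁

end Summit.BirchSwinnertonDyer.Uniform.UI

end
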